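/-
Copyright (c) 2026 the pub-hodgecm-mathlib formalisation cell (harness21).  Prover seat hodgecm-mathlib-LH4-p12 (g4) (plan owner of the (ρ2b′-X) payer road, dealer LH4-plan (g12)
WORD #9; payer of record LH4-p14 (g3) «=» ON SHAPE 03:55:54Z, requirements (R1)(R2)), Track A «(D-RAM) FOUR-FRAME», unit U2H.  2026-09-04.
-/
import Literature.NumberTheory.LocalFields.QuadraticOrderNormLine   -- ★ p857156 → ★ T4 chain p857067 ∕ p857040 ∕ p857021 (orders `𝒪^ρ + c𝒪`, Mars 2-free, `Λ^# = y⁻¹Λ`)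
import HarnessLib

/-!
# DEFS LEAF of the toric census of (ρ2b′-X): the order predicate `IsOrd`, the dual generator `dualGen`, the u-free LEVEL SETS `levelSet j a`, their DEPTH refinement
# `levelSetDep j a μ` (R1), and the GLUE UNIT `glueUnit` with its norm-class predicate (R2) — ONE vocabulary for T5a ∕ T5b ∕ T5c ∕ O-W ∕ O-Cone ∕ O-Sum ∕ T6

Cell `pub/hodgecm-mathlib` (D-0151), FLOOR 0, crux H413 = `stmt-HodgeConjecture-24833`, Track A «(D-RAM) FOUR-FRAME», unit U2H, leaf (ρ2b′-X) `stub_U2H_fixedPointCensus_typeTwo_unit0`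
(OPEN-CONFIRMED, heir LEAD T18-55; RHO2BX-ORDER v1 LH4-p14 (g3)).  DEFINITIONS WITH BODIES + `Iff.rfl`∕`rfl` unfolding lemmas and two bridges to ★ T4 (no theorem content, no instance,
no notation, no `sorry`).  These are EXACTLY the local `def`s of the three statement sheets T5a (LH4-p08 (g4) `T5aToricLevelCensusUnr.statements.v1` 5798dd15), T5b (F0P3-p01 (g32)
`T5bToricLevelCensusRamK.statements.v1` 3d214903), T5c (LH4-p06 (g4) `…RamM.statements.v2` 69f51c6a) — payer «=» ON SHAPE 03:55:54Z — with ONE change that makes them a single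
definition across types: the level clause reads **`|y| = |ϖE|^a`** (= `exp(−a)` when `ϖE` is a uniformiser of `M`, T5a; `= exp(−2a)` when `|ϖE| = exp(−2)`, T5c), plus the payer's
two requirements: (R1) the DEPTH-REFINED set `levelSetDep j a μ` (`μ = λ − u`; the tube ∕ depth condition `μ·Λ^# ⊆ Λ` stated INTRINSICALLY on `Λ`), (R2) the GLUE UNIT
`glueUnit = −⟨w₀, w₀⟩·(ϖE·ΘϖE)^a ∕ c_U` of the dual generator `w₀ = y⁻¹x₀` (`⟨w₀,w₀⟩ = Tr_{M∕E}(h·Θ(w₀)·w₀)`), whose norm class `IsGlueNorm` (a norm from the `ρ`-fixed units) is the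
`r` of ★ T1's norm fibres `Sol_{2a}(r)` (p856820∕47∕61) and the predicate of the HALF SPLIT (E1 (L1)).

CURRENCY = ★ T4 (LH4-p12 (g4) p857021 ∕ p857040 ∕ p857067 ∕ p857156, namespace `Literature.NumberTheory.LocalFields.QuadraticOrder`): ONE field `K` = model of `M = E·K_γ` with
`Valued K ℤᵐ⁰`, `ρ = Gal(M∕E)`, `Θ` = the adjoint involution (fixes `K♮`; `Θ|_E = σ`), `α` the integral generator (`hint`), `ϖE` a `ρ`-fixed element of `E` (model: its uniformiser),
the form scalar `h` (`Θh = h`), the line value `cU` of the block's `U`-part.  Frame predicates stay in the sheets (`IsUnrMFrame` ∕ `IsRamKFrame` ∕ `IsRamMFrame`).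
HONEST LABEL: definitions only — nothing is asserted; HC_CM is proved only modulo the 7 printed citations (2 remaining named inputs: hLiu418 = stmt-HodgeConjecture-24832, h413 =
stmt-HodgeConjecture-24833) until rung 0 closes.

* §1 `IsOrd ρ α c z` (the order of conductor `c`, ★ T4's spelled-out predicate; `isOrd_iff` by `Iff.rfl`) · `dualGen ρ Θ α c h x₀ = h·(x₀Θx₀)·(c(α − ρα))` (★ T4c's `y`).
* §2 `levelSet ρ Θ α ϖE h j a : Set (AddSubgroup K)` (u-free: `Λ = x₀·𝒪_j`, `y ∈ 𝒪_j`, `y∕ϖE ∉ 𝒪_j`, `|y| = |ϖE|^a`) · `levelSetDep … j a μ` (R1: `∩ {Λ | μ·Λ^# ⊆ Λ}` intrinsically).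
* §3 `glueUnit ρ Θ α c h ϖE cU a x₀` (R2) and `IsGlueNorm ρ Θ r :≡ ∃ e, ρe = e ∧ |e| = 1 ∧ e·Θe = r`.
* §4 bridges: `mem_levelSet_iff`, `mem_levelSetDep_iff` (unfoldings); **`levelSet_dual_eq`**: for `Λ ∈ levelSet`, the hermitian dual of `Λ` is `y⁻¹Λ` (★ T4c
  `forall_mem_v_herm_le_one_iff_exists` by name); **`mem_levelSetDep_iff_isOrd_div`**: the depth clause ⟺ `IsOrd (μ ∕ y)` for any generator (★ `forall_dual_mul_mem_iff`).

## References
* [Jacobowitz1962] R. Jacobowitz, *Hermitian forms over local fields*, Amer. J. Math. 84 (1962), §4 (duals, modular lattices, gluing).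
* [Serre1979] J.-P. Serre, *Local Fields*, GTM 67 (1979), Ch. III §6 Prop. 11–12; Ch. V §3.
* [Kottwitz1986BaseChangeUnits] R. E. Kottwitz, *Base change for unit elements of Hecke algebras*, Compositio Math. 60 (1986), §1 pp. 240–241.
-/

set_option autoImplicit false

noncomputable section

open WithZero
open Literature.NumberTheory.LocalFields.QuadraticOrder

namespace Summit.HodgeConjecture.HodgeConjecture.Cruxes.H413.F0P3cDyRamToricCensusDefs

variable {K : Type*} [Field K] [Valued K ℤᵐ⁰]

/-! ## §1 The order predicate and the dual generator -/

/-- **The ORDER OF CONDUCTOR `c`** (`𝒪_E + c·𝒪_M` read on the one field `M`): `|z| ≤ 1 ∧ |z − ρz| ≤ |c(α − ρα)|` — ★ T4's spelled-out predicate, now a name.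
[cite: Serre1979, Ch. III §6 Prop. 12] -/
def IsOrd (ρ : K →+* K) (α c z : K) : Prop := Valued.v z ≤ 1 ∧ Valued.v (z - ρ z) ≤ Valued.v (c * (α - ρ α))

/-- Unfolding of `IsOrd` (definitional). [cite: Serre1979, Ch. III §6 Prop. 12] -/
theorem isOrd_iff (ρ : K →+* K) (α c z : K) : IsOrd ρ α c z ↔ (Valued.v z ≤ 1 ∧ Valued.v (z - ρ z) ≤ Valued.v (c * (α - ρ α))) := Iff.rfl

/-- **The DUAL GENERATOR `y = h·(x₀Θx₀)·(c(α − ρα))`** of the lattice `x₀·𝒪_c` for the form `Tr_{M∕E}(h·Θ(a)·b)` (★ T4c: `Λ^# = y⁻¹Λ`). [cite: Jacobowitz1962, §4] -/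
def dualGen (ρ Θ : K →+* K) (α c h x₀ : K) : K := h * (x₀ * Θ x₀) * (c * (α - ρ α))

omit [Valued K ℤᵐ⁰] in
/-- Unfolding of `dualGen` (definitional). [cite: Jacobowitz1962, §4] -/
theorem dualGen_def (ρ Θ : K →+* K) (α c h x₀ : K) : dualGen ρ Θ α c h x₀ = h * (x₀ * Θ x₀) * (c * (α - ρ α)) := rfl

/-! ## §2 The u-free level sets and their depth refinement (R1) -/

/-- **THE u-FREE LEVEL SET `L_h(j, a)`**: additive subgroups `Λ = x₀·𝒪_j` of `M` (`𝒪_j` = the order of conductor `ϖE^j`) that are INTEGRAL (`y ∈ 𝒪_j`), GRAM-PRIMITIVE (`y∕ϖE ∉ 𝒪_j`)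
and of LEVEL `a`: `|y| = |ϖE|^a` (one clause for all types: `exp(−a)` when `ϖE` is a uniformiser of `M`, `exp(−2a)` when `|ϖE| = exp(−2)`).  λ-stability (`j ≤ j_λ`) and the depth
condition are carried by the consumer ∕ by `levelSetDep`. [cite: Jacobowitz1962, §4] [cite: Kottwitz1986BaseChangeUnits, §1 pp. 240–241] -/
def levelSet (ρ Θ : K →+* K) (α ϖE h : K) (j a : ℕ) : Set (AddSubgroup K) :=
  {Λ | ∃ x₀ : K, x₀ ≠ 0 ∧ (∀ x, x ∈ Λ ↔ ∃ z, IsOrd ρ α (ϖE ^ j) z ∧ x = x₀ * z) ∧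
      IsOrd ρ α (ϖE ^ j) (dualGen ρ Θ α (ϖE ^ j) h x₀) ∧ ¬ IsOrd ρ α (ϖE ^ j) (dualGen ρ Θ α (ϖE ^ j) h x₀ / ϖE) ∧
      Valued.v (dualGen ρ Θ α (ϖE ^ j) h x₀) = Valued.v ϖE ^ a}

/-- Unfolding of `levelSet` (definitional). [cite: Jacobowitz1962, §4] -/
theorem mem_levelSet_iff (ρ Θ : K →+* K) (α ϖE h : K) (j a : ℕ) (Λ : AddSubgroup K) :
    Λ ∈ levelSet ρ Θ α ϖE h j a ↔ ∃ x₀ : K, x₀ ≠ 0 ∧ (∀ x, x ∈ Λ ↔ ∃ z, IsOrd ρ α (ϖE ^ j) z ∧ x = x₀ * z) ∧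
      IsOrd ρ α (ϖE ^ j) (dualGen ρ Θ α (ϖE ^ j) h x₀) ∧ ¬ IsOrd ρ α (ϖE ^ j) (dualGen ρ Θ α (ϖE ^ j) h x₀ / ϖE) ∧
      Valued.v (dualGen ρ Θ α (ϖE ^ j) h x₀) = Valued.v ϖE ^ a := Iff.rfl

/-- **(R1) THE DEPTH-REFINED LEVEL SET `L_h(j, a; μ)`** (`μ = λ − u`): members of `levelSet j a` satisfying the TUBE ∕ DEPTH CONDITION `μ·Λ^# ⊆ Λ`, stated intrinsically on `Λ`:
every `b` pairing integrally with `Λ` under `Tr(h·Θ(a)·b)` has `μ·b ∈ Λ`.  This is what O-Sum sums (`q^a · #levelSetDep`). [cite: Kottwitz1986BaseChangeUnits, §1 pp. 240–241] -/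
def levelSetDep (ρ Θ : K →+* K) (α ϖE h : K) (j a : ℕ) (μ : K) : Set (AddSubgroup K) :=
  {Λ | Λ ∈ levelSet ρ Θ α ϖE h j a ∧ ∀ b, (∀ x ∈ Λ, Valued.v (h * Θ x * b + ρ (h * Θ x * b)) ≤ 1) → μ * b ∈ Λ}

/-- Unfolding of `levelSetDep` (definitional). [cite: Kottwitz1986BaseChangeUnits, §1 pp. 240–241] -/
theorem mem_levelSetDep_iff (ρ Θ : K →+* K) (α ϖE h : K) (j a : ℕ) (μ : K) (Λ : AddSubgroup K) :
    Λ ∈ levelSetDep ρ Θ α ϖE h j a μ ↔ Λ ∈ levelSet ρ Θ α ϖE h j a ∧ ∀ b, (∀ x ∈ Λ, Valued.v (h * Θ x * b + ρ (h * Θ x * b)) ≤ 1) → μ * b ∈ Λ := Iff.rfl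

/-- `levelSetDep ⊆ levelSet`. [cite: Kottwitz1986BaseChangeUnits, §1 pp. 240–241] -/
theorem levelSetDep_subset (ρ Θ : K →+* K) (α ϖE h : K) (j a : ℕ) (μ : K) : levelSetDep ρ Θ α ϖE h j a μ ⊆ levelSet ρ Θ α ϖE h j a :=
  fun _ hΛ => hΛ.1

/-! ## §3 The glue unit and its norm class (R2) -/

/-- **(R2) THE GLUE UNIT** of the lattice `x₀·𝒪_c` at level `a`: `r = −⟨w₀, w₀⟩·(ϖE·ΘϖE)^a ∕ c_U` where `w₀ = y⁻¹x₀` generates `Λ^# ∕ Λ`, `⟨w₀, w₀⟩ = Tr_{M∕E}(h·Θ(w₀)·w₀) =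
t + ρt` with `t = h·(x₀Θx₀) ∕ (y·Θy)`, `ΘϖE = σϖE`, and `c_U` is the `U`-part line value of the block — the `r` of ★ T1's norm fibres `Sol_{2a}(r)` (PAYER-PLAN D5 `ξ`; payer (R2)).
[cite: Jacobowitz1962, §4] -/
def glueUnit (ρ Θ : K →+* K) (α c h ϖE cU x₀ : K) (a : ℕ) : K :=
  -((h * (x₀ * Θ x₀) / (dualGen ρ Θ α c h x₀ * Θ (dualGen ρ Θ α c h x₀)) +
      ρ (h * (x₀ * Θ x₀) / (dualGen ρ Θ α c h x₀ * Θ (dualGen ρ Θ α c h x₀)))) * (ϖE * Θ ϖE) ^ a / cU)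

omit [Valued K ℤᵐ⁰] in
/-- Unfolding of `glueUnit` (definitional). [cite: Jacobowitz1962, §4] -/
theorem glueUnit_def (ρ Θ : K →+* K) (α c h ϖE cU x₀ : K) (a : ℕ) :
    glueUnit ρ Θ α c h ϖE cU x₀ a =
      -((h * (x₀ * Θ x₀) / (dualGen ρ Θ α c h x₀ * Θ (dualGen ρ Θ α c h x₀)) +
          ρ (h * (x₀ * Θ x₀) / (dualGen ρ Θ α c h x₀ * Θ (dualGen ρ Θ α c h x₀)))) * (ϖE * Θ ϖE) ^ a / cU) := rfl

/-- **THE NORM-CLASS PREDICATE OF THE HALF SPLIT**: `r` is a norm from the `ρ`-fixed UNITS, `r = e·Θe` with `ρe = e`, `|e| = 1` (`Θ|_E = σ`, so this is `r ∈ N_{E∕F}(𝒪_Eˣ)`).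
[cite: Serre1979, Ch. V §3] -/
def IsGlueNorm (ρ Θ : K →+* K) (r : K) : Prop := ∃ e : K, ρ e = e ∧ Valued.v e = 1 ∧ e * Θ e = r

/-- Unfolding of `IsGlueNorm` (definitional). [cite: Serre1979, Ch. V §3] -/
theorem isGlueNorm_iff (ρ Θ : K →+* K) (r : K) : IsGlueNorm ρ Θ r ↔ ∃ e : K, ρ e = e ∧ Valued.v e = 1 ∧ e * Θ e = r := Iff.rfl

/-! ## §4 Bridges to ★ T4 (by name) -/

/-- **THE DUAL OF A LEVEL-SET MEMBER IS `y⁻¹Λ`** (★ T4c `forall_mem_v_herm_le_one_iff_exists` by name): for `Λ = x₀·𝒪_c` (`x₀, h, c ≠ 0`), `b` pairs integrally with `Λ` iff `b = y⁻¹·(x₀·z)`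
with `z ∈ 𝒪_c`, `y = dualGen`. [cite: Jacobowitz1962, §4] -/
theorem forall_mem_herm_iff_exists {ρ Θ : K →+* K} {α : K} (hρρ : ∀ x, ρ (ρ x) = x) (hvρ : ∀ x, Valued.v (ρ x) = Valued.v x) (hα : ρ α ≠ α) (hα1 : Valued.v α ≤ 1)
    (hint : ∀ z : K, Valued.v z ≤ 1 → Valued.v ((z - ρ z) / (α - ρ α)) ≤ 1)
    (hΘΘ : ∀ x, Θ (Θ x) = x) (hΘρ : ∀ x, Θ (ρ x) = ρ (Θ x)) (hvΘ : ∀ x, Valued.v (Θ x) = Valued.v x)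
    {c : K} (hc : ρ c = c) (hc0 : c ≠ 0) (hc1 : Valued.v c ≤ 1) {h : K} (hh : h ≠ 0) {Λ : AddSubgroup K} {x₀ : K} (hx₀ : x₀ ≠ 0)
    (hΛ : ∀ x, x ∈ Λ ↔ ∃ z, IsOrd ρ α c z ∧ x = x₀ * z) (b : K) :
    (∀ x ∈ Λ, Valued.v (h * Θ x * b + ρ (h * Θ x * b)) ≤ 1) ↔ ∃ z, IsOrd ρ α c z ∧ b = (dualGen ρ Θ α c h x₀)⁻¹ * (x₀ * z) :=
  forall_mem_v_herm_le_one_iff_exists hρρ hvρ hα hα1 hint hΘΘ hΘρ hvΘ hc hc0 hc1 hh hx₀ hΛ b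

/-- **THE DEPTH CLAUSE IN `y`-CURRENCY** (★ T4c `forall_dual_mul_mem_iff` by name): for `Λ = x₀·𝒪_c`, `μ·Λ^# ⊆ Λ ⟺ IsOrd (μ ∕ y)`. [cite: Kottwitz1986BaseChangeUnits, §1 pp. 240–241] -/
theorem forall_herm_mul_mem_iff_isOrd_div {ρ Θ : K →+* K} {α : K} (hρρ : ∀ x, ρ (ρ x) = x) (hvρ : ∀ x, Valued.v (ρ x) = Valued.v x) (hα : ρ α ≠ α) (hα1 : Valued.v α ≤ 1)
    (hint : ∀ z : K, Valued.v z ≤ 1 → Valued.v ((z - ρ z) / (α - ρ α)) ≤ 1)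
    (hΘΘ : ∀ x, Θ (Θ x) = x) (hΘρ : ∀ x, Θ (ρ x) = ρ (Θ x)) (hvΘ : ∀ x, Valued.v (Θ x) = Valued.v x)
    {c : K} (hc : ρ c = c) (hc0 : c ≠ 0) (hc1 : Valued.v c ≤ 1) {h : K} (hh : h ≠ 0) {Λ : AddSubgroup K} {x₀ : K} (hx₀ : x₀ ≠ 0)
    (hΛ : ∀ x, x ∈ Λ ↔ ∃ z, IsOrd ρ α c z ∧ x = x₀ * z) (μ : K) :
    (∀ b, (∀ x ∈ Λ, Valued.v (h * Θ x * b + ρ (h * Θ x * b)) ≤ 1) → μ * b ∈ Λ) ↔ IsOrd ρ α c (μ / dualGen ρ Θ α c h x₀) :=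
  forall_dual_mul_mem_iff hρρ hvρ hα hα1 hint hΘΘ hΘρ hvΘ hc hc0 hc1 hh hx₀ hΛ μ

end Summit.HodgeConjecture.HodgeConjecture.Cruxes.H413.F0P3cDyRamToricCensusDefs

end
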